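import Literature.Analysis.FunctionSpaces.PVDefinability
import Literature.Analysis.FunctionSpaces.PVTheoryTranslationProofs
import Literature.Computability.MetaComplexity.BoundedArithT2SuccPIND
import HarnessLib

/-!
# `S₂ⁱ⁺¹(PV) ⊆ T₂ⁱ⁺¹(PV)`: `Σᵇᵢ₊₁(PV)`-polynomial induction in models of `T₂ⁱ⁺¹(PV)`
(discharge of the named facts `S2PV_succ_extends_to_T2PV_succ` and `S2PV_extends_to_T2PV` of
`PVTheory.lean`)

Sibling proof file of `PVTheory.lean` (D-0014).  It proves

* `Literature.Analysis.FunctionSpaces.S2PV_succ_extends_to_T2PV_succ_holds` — for every `i`, the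
  theory `T₂ⁱ⁺¹(PV)` (`T2PV (i + 1)`) proves every axiom of `S₂ⁱ⁺¹(PV)` (`S2PV (i + 1)`), i.e.
  `Σᵇᵢ₊₁(PV)-PIND` follows from `Σᵇᵢ₊₁(PV)-IND` over `BASIC` and the defining equations of the
  `PV` symbols (Buss 1986, Thm. 2.6 and its corollary `S₂ⁱ ⊆ T₂ⁱ`, relativised to the language
  of `PV` as in Ch. 6; Krajíček 1995, Lemma 5.2.8 (p. 68) via Lemma 5.2.5 (p. 67));
* `Literature.Analysis.FunctionSpaces.S2PV_extends_to_T2PV_holds` — the same with the hypothesis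
  `1 ≤ i` (the form `S2PV_extends_to_T2PV`).

Provability is Mathlib's semantic `⊨ᵇ`, so the content is: every model `M` of `T₂ⁱ⁺¹(PV)` is a
model of `S₂ⁱ⁺¹(PV)` (`model_S2PV_of_model_T2PV_succ`).

## The argument (Krajíček 1995, proof of Lemma 5.2.5, p. 67, and Lemma 5.2.8, p. 68)

Let `M ⊨ T₂ⁱ⁺¹(PV)`, let `A(x)` be a `Σᵇᵢ₊₁(PV)` formula with parameters from `M` such that
`A(0)` and `∀x (A(⌊x/2⌋) → A(x))`, and let `a ∈ M`.  Put `ψ(x) :≡ A(aₓ)` with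
`aₓ := ⌊a / 2^{|a| ∸ x}⌋`, "the number consisting of the first `x` bits of `a`".  Then `ψ(0)` is
`A(0)`, `ψ(x) → ψ(x+1)` is an instance of the `PIND` hypothesis (`aₓ = ⌊aₓ₊₁/2⌋` for `x < |a|`,
`aₓ₊₁ = aₓ` for `x ≥ |a|`), and `ψ` is again `Σᵇᵢ₊₁(PV)` because the function `(x ↦ aₓ)` is
`Σᵇ₁`-definable (Krajíček: "`ψ(x)` is `Σᵇᵢ` as `aₓ = y` is `Σᵇ₁`-definable"; Buss 1986, Thm. 2.2);
so `Σᵇᵢ₊₁(PV)-IND` gives `ψ(|a|)`, i.e. `A(a)`.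

This is literally the argument by which `BoundedArithT2SuccPIND.lean` discharges the same fact for
Buss's original language `L(S₂)` (`BASICModel.pind_of_ind_succ`), and the present file REUSES
that bootstrapping instead of redoing it over `L(PV)`:

1. *Reduct.*  An `L(PV)`-structure `M` is read as an `L(S₂)`-structure through the reduct
   `pvReduct M` along the embedding `boundedArithToPV` (`PVDefinability.lean`; a local instance,
   as there).  Since the translation of `T₂ⁱ` lies in `T₂ⁱ(PV)` axiom-wise
   (`onTheory_T2_subset_T2PV`, `PVTheoryTranslationProofs.lean`), a model of `T₂ⁱ⁺¹(PV)` is a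
   model of `T₂ⁱ⁺¹ ⊇ T₂¹` in Buss's language (`model_T2_of_model_T2PV`), so the algebraic
   bootstrapping of `BoundedArithAlgebra.lean` / `BoundedArithPow2.lean` (ordered semiring
   structure, `∸`, the powers of two `pow2B a k = 2^{min(k,|a|)}`, Euclidean division, and their
   `Σᵇ₁`-definability in Buss's language) is available in `M`.
2. *Substitution of `Σᵇ₁`-definable functions of `L(S₂)` into `Σᵇᵢ₊₁(PV)` predicates.*  The
   induction formula `ψ` mentions arbitrary `PV` symbols (through `A`), so it is handled by the
   `Σᵇᵢ(PV)`-definability interface `IsSigmabPVDef` of `PVDefinability.lean`; what is added here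
   is the transfer of Buss-language definability along the embedding (`IsTermFn.isPVTermFn`,
   `IsSigmabDef.isSigmabPVDef`, via `IsSigmab.onBoundedFormula`) and hence the substitution of a
   function with a `Σᵇᵢ₊₁`-definable graph and a bounding term of `L(S₂)` into a
   `Σᵇᵢ₊₁(PV)`-definable predicate (`IsSigmabPVDef.snocFn`, `IsSigmabPVDef.comp₁Fn`; Buss 1986,
   Thm. 2.2: `R(x̄, F(x̄)) ↔ ∃ y ≤ t(x̄) (y = F(x̄) ∧ R(x̄, y))`).
3. *The induction.*  `pind_of_pvInd_succ` is then the proof of `BASICModel.pind_of_ind_succ`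
   verbatim, with `Σᵇᵢ₊₁(PV)-IND` (`IsSigmabPVDef.induction'`) in place of `Σᵇᵢ₊₁-IND`;
   `model_S2PV_of_model_T2PV_succ` and the two discharges follow.

## References

* S. R. Buss, *Bounded Arithmetic*, Bibliopolis 1986, Ch. 2 (Thm. 2.2: substitution of
  `Σᵇ₁`-defined functions; Thm. 2.6 and its corollary `S₂ⁱ ⊆ T₂ⁱ` for `i ≥ 1`) and Ch. 6 (the
  theories over the language of `PV`).
* J. Krajíček, *Bounded Arithmetic, Propositional Logic and Complexity Theory*, Encyclopedia
  Math. Appl. 60, CUP 1995, Lemma 5.2.5 (p. 67: `S₂ⁱ = Σᵇᵢ-LIND`, proof via `ψ(x) := φ(aₓ)`),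
  Lemma 5.2.8 (p. 68: `S₂ⁱ ⊆ T₂ⁱ ⊆ S₂ⁱ⁺¹` for `i ≥ 1`), §5.3 (p. 73: the theories `S₂ⁱ(PV)`).

## Design choices

* As in `PVDefinability.lean`, `pvReduct` and `isExpansionOn_pvReduct` are activated as *local*
  instances only; every declaration is generic in the `L(PV)`-structure `M : Type`.
* The level is written `i + 1`; the case `i = 0` is not a theorem of the sources and is not
  claimed (cf. the docstring of `S2PV_extends_to_T2PV`).
-/

namespace Literature.Analysis.FunctionSpaces

open FirstOrder FirstOrder.Language FirstOrder.Language.BoundedFormula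
open Literature.Computability.MetaComplexity

attribute [local instance] pvReduct isExpansionOn_pvReduct

/-! ## From `L(S₂)`-definability to `L(PV)`-definability along the embedding -/

section Transfer

variable {M : Type} [Language.pv.Structure M] {m i : ℕ}
  {P : (Fin m → M) → Prop} {R : (Fin (m + 1) → M) → Prop} {F : (Fin m → M) → M}

/-- A function given by an `L(S₂)`-term with parameters (on the reduct) is given by an
`L(PV)`-term with parameters: translate the term (Mathlib `LHom.onTerm`, `LHom.realize_onTerm`)
(Buss 1986, Ch. 6: `L(S₂) ⊆ L(PV)`). [cite: Buss1986, Ch. 6] -/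
theorem _root_.Literature.Computability.MetaComplexity.IsTermFn.isPVTermFn (hF : IsTermFn F) :
    IsPVTermFn F := by
  obtain ⟨t, ht⟩ := hF
  exact ⟨boundedArithToPV.onTerm t, fun xs => by rw [ht, LHom.realize_onTerm]⟩

/-- **Transfer along the embedding.**  A predicate definable with parameters by a `Σᵇᵢ` formula of
Buss's language (on the reduct) is definable by a `Σᵇᵢ(PV)` formula: translate the defining
formula (`IsSigmab.onBoundedFormula`; Mathlib `LHom.realize_onFormula`) (Buss 1986, Ch. 6:
`Σᵇᵢ ⊆ Σᵇᵢ(PV)`). [cite: Buss1986, Ch. 6] -/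
theorem _root_.Literature.Computability.MetaComplexity.IsSigmabDef.isSigmabPVDef
    (hP : IsSigmabDef i P) : IsSigmabPVDef i P := by
  obtain ⟨φ, hφ, h⟩ := hP
  exact ⟨boundedArithToPV.onFormula φ, IsSigmab.onBoundedFormula hφ, fun xs => by
    rw [h, LHom.realize_onFormula]⟩

/-- **Substitution of a `Σᵇᵢ₊₁`-definable function into a `Σᵇᵢ₊₁(PV)` predicate**:
`R(x̄, F(x̄)) ↔ ∃ y ≤ t(x̄) (y = F(x̄) ∧ R(x̄, y))` for `F` with a `Σᵇᵢ₊₁`-definable graph and a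
bounding term in Buss's language (Buss 1986, Thm. 2.2, read in `L(PV)`, Ch. 6; cf.
`IsSigmabDef.snocFn`). [cite: Buss1986, Thm. 2.2] -/
theorem IsSigmabPVDef.snocFn (hR : IsSigmabPVDef (i + 1) R) (hF : IsSigmabFn (i + 1) F) :
    IsSigmabPVDef (i + 1) fun xs => R (Fin.snoc xs (F xs)) := by
  obtain ⟨B, hB, hFB⟩ := hF.bounded
  refine ((hF.graph.isSigmabPVDef.and hR).bexLE hB.isPVTermFn).of_iff fun xs => ?_
  simp only [graphPred_snoc]
  constructor
  · rintro ⟨y, -, rfl, hy⟩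
    exact hy
  · intro hxs
    exact ⟨F xs, hFB xs, rfl, hxs⟩

/-- Substituting a `Σᵇᵢ₊₁`-definable function of Buss's language into a unary
`Σᵇᵢ₊₁(PV)`-definable predicate (Buss 1986, Thm. 2.2; cf. `IsSigmabDef.comp₁Fn`).
[cite: Buss1986, Thm. 2.2] -/
theorem IsSigmabPVDef.comp₁Fn {P : M → Prop}
    (hP : IsSigmabPVDef (i + 1) fun v : Fin 1 → M => P (v 0)) (hF : IsSigmabFn (i + 1) F) :
    IsSigmabPVDef (i + 1) fun xs => P (F xs) :=
  ((hP.comp fun _ : Fin 1 => Fin.last m).snocFn hF).of_iff fun xs => by simp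

end Transfer

/-! ## A model of `T₂ⁱ(PV)` read in Buss's language -/

section Models

variable {M : Type} [Language.pv.Structure M] {i k : ℕ}

/-- **A model of `T₂ⁱ(PV)` is a model of `T₂ⁱ`** when read in Buss's language (on the reduct): the
translation of `T₂ⁱ` lies in `T₂ⁱ(PV)` axiom-wise (`onTheory_T2_subset_T2PV`) and a structure
satisfies a translated theory iff its reduct satisfies the theory (Mathlib `LHom.onTheory_model`)
(Buss 1986, Ch. 6: `T₂ⁱ ⊆ T₂ⁱ(PV)`). [cite: Buss1986, Ch. 6] -/
theorem model_T2_of_model_T2PV (h : M ⊨ T2PV i) : M ⊨ T2 i :=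
  (LHom.onTheory_model boundedArithToPV (T2 i)).1 (h.mono (onTheory_T2_subset_T2PV i))

/-- A model of `T₂ⁱ(PV)` is a model of `BASIC`, read in Buss's language (Buss 1986, Ch. 6).
[cite: Buss1986, Ch. 6] -/
theorem model_BASIC_of_model_T2PV (h : M ⊨ T2PV i) : M ⊨ BASIC :=
  model_BASIC_of_model_T2 (model_T2_of_model_T2PV h)

/-- A model of `T₂ⁱ(PV)` satisfies the scheme `Σᵇᵢ(PV)-IND` (by definition of `T2PV`; Buss 1986,
§2.4, Ch. 6). [cite: Buss1986, §2.4] -/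
theorem model_pvIND_of_model_T2PV (h : M ⊨ T2PV i) :
    M ⊨ ⋃ k, pvIndAxiom '' sigmabPVFormulas i k :=
  h.mono Set.subset_union_right

/-- The `IND` axiom over `L(PV)` of a `Σᵇᵢ(PV)` formula belongs to the scheme `Σᵇᵢ(PV)-IND`
(Buss 1986, §2.4, Ch. 6). [cite: Buss1986, §2.4] -/
theorem pvIndAxiom_mem_pvIND {φ : Language.pv.Formula (Fin (k + 1))} (hφ : IsSigmabPV i φ) :
    pvIndAxiom φ ∈ ⋃ k, pvIndAxiom '' sigmabPVFormulas i k :=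
  Set.mem_iUnion.2 ⟨k, Set.mem_image_of_mem _ hφ⟩

/-- A structure satisfying `Σᵇᵢ(PV)-IND` satisfies Buss's scheme `Σᵇᵢ-IND` on the reduct: the
translation of the `IND` axiom of a `Σᵇᵢ` formula is the `IND` axiom of its translation, a
`Σᵇᵢ(PV)` formula (`onSentence_indAxiom`, `IsSigmab.onBoundedFormula`) (Buss 1986, Ch. 6:
`T₂ⁱ ⊆ T₂ⁱ(PV)`). [cite: Buss1986, Ch. 6] -/
theorem model_INDScheme_of_model_pvIND (hI : M ⊨ ⋃ k, pvIndAxiom '' sigmabPVFormulas i k) :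
    M ⊨ INDScheme (sigmabFormulas i) := by
  refine ⟨fun σ hσ => ?_⟩
  simp only [INDScheme, Set.mem_iUnion, Set.mem_image] at hσ
  obtain ⟨k, ψ, hψ, rfl⟩ := hσ
  have h := hI.realize_of_mem (pvIndAxiom (boundedArithToPV.onFormula ψ))
    (pvIndAxiom_mem_pvIND (IsSigmab.onBoundedFormula hψ))
  rw [← onSentence_indAxiom] at h
  exact (LHom.realize_onSentence M boundedArithToPV _).1 h

end Models

/-! ## `Σᵇᵢ₊₁(PV)`-polynomial induction from `Σᵇᵢ₊₁(PV)`-induction -/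

section PIND

open BASICModel

variable {M : Type} [Language.pv.Structure M]

/-- `Σᵇᵢ(PV)-IND` for definable predicates in algebraic notation (`0`, `a + 1` of a model of
`BASIC`, `BoundedArithAlgebra.lean`) (Buss 1986, §2.4, Ch. 6; from `IsSigmabPVDef.induction'`).
[cite: Buss1986, §2.4] -/
theorem IsSigmabPVDef.ind [M ⊨ BASIC] {i : ℕ} (hI : M ⊨ ⋃ k, pvIndAxiom '' sigmabPVFormulas i k)
    {P : M → Prop} (hP : IsSigmabPVDef i fun v : Fin 1 → M => P (v 0)) (h0 : P 0)
    (hs : ∀ a, P a → P (a + 1)) (a : M) : P a :=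
  hP.induction' hI h0 (fun a ha => by simpa using hs a ha) a

/-- The induction predicate of Krajíček's argument is `Σᵇᵢ₊₁(PV)`: for `A ∈ Σᵇᵢ₊₁(PV)` (with
parameters) and a parameter `a`, `ψ(x) :≡ A(⌊a / 2^{|a| ∸ x}⌋)` is `Σᵇᵢ₊₁(PV)`-definable with
parameters, in a model of `BASIC + Σᵇ₁-IND` — substitution of the `Σᵇ₁`-definable functions
`∸` and `(x, k) ↦ ⌊x/2ᵏ⌋` of Buss's language into a `Σᵇᵢ₊₁(PV)` formula (Buss 1986, Thm. 2.2;
Krajíček 1995, proof of Lemma 5.2.5, p. 67: "`ψ(x)` is `Σᵇᵢ` as `aₓ = y` is `Σᵇ₁`-definable";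
cf. `BASICModel.isSigmabDef_prefix`). [cite: Krajicek1995, Lemma 5.2.5 (p. 67)] -/
theorem isSigmabPVDef_prefix [M ⊨ BASIC] [M ⊨ INDScheme (sigmabFormulas 1)] {i : ℕ}
    {A : M → Prop} (hA : IsSigmabPVDef (i + 1) fun v : Fin 1 → M => A (v 0)) (a : M) :
    IsSigmabPVDef (i + 1) fun v : Fin 1 → M => A (a / pow2B a (mLen a - v 0)) := by
  -- `d ↦ A (⌊a / 2ᵈ⌋)` is `Σᵇᵢ₊₁(PV)`
  have h1 : IsSigmabPVDef (i + 1) fun v : Fin 1 → M => A (a / pow2B a (v 0)) :=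
    hA.comp₁Fn ((isSigmabFn_div_pow2B.mono (Nat.le_add_left 1 i)).comp₃
      (f := fun S x k => x / pow2B S k) (IsTermFn.const a) (IsTermFn.const a) (IsTermFn.proj 0))
  -- substitute `d := |a| ∸ x`
  exact h1.comp₁Fn (P := fun d => A (a / pow2B a d))
    (isSigmabFn_sub (isTermFn_mLen (IsTermFn.const a)) (IsTermFn.proj 0) (i + 1))

/-- **`Σᵇᵢ₊₁(PV)-PIND` in models of `BASIC + Σᵇᵢ₊₁(PV)-IND`** (`S₂ⁱ(PV) ⊆ T₂ⁱ(PV)` for `i ≥ 1`: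
Buss 1986, Thm. 2.6 and its corollary, Ch. 6; Krajíček 1995, Lemma 5.2.8 with Lemma 5.2.5,
pp. 67–68): if `A ⊆ M` is `Σᵇᵢ₊₁(PV)`-definable with parameters, `A(0)` and
`∀x (A(⌊x/2⌋) → A(x))`, then `A = M`.  Proof: `Σᵇᵢ₊₁(PV)-IND` on `x` for
`ψ(x) :≡ A(⌊a / 2^{|a| ∸ x}⌋)`, from `ψ(0) ≡ A(0)` up to `ψ(|a|) ≡ A(a)`; the induction step is
the `PIND` hypothesis since `⌊a/2^{|a| ∸ x}⌋ = ⌊⌊a/2^{|a| ∸ (x+1)}⌋ / 2⌋` for `x < |a|` (the proof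
of `BASICModel.pind_of_ind_succ` verbatim; the algebra of `∸`, `pow2B`, `/` is that of a model of
`T₂¹`, which `M` is by `model_INDScheme_of_model_pvIND` and cumulativity).
[cite: Krajicek1995, Lemma 5.2.8 (p. 68)] -/
theorem pind_of_pvInd_succ [M ⊨ BASIC] {i : ℕ}
    (hI : M ⊨ ⋃ k, pvIndAxiom '' sigmabPVFormulas (i + 1) k) {A : M → Prop}
    (hA : IsSigmabPVDef (i + 1) fun v : Fin 1 → M => A (v 0)) (h0 : A 0)
    (hs : ∀ x, A (mHalf x) → A x) (a : M) : A a := by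
  haveI : M ⊨ INDScheme (sigmabFormulas 1) :=
    model_INDScheme_one_of_level (model_INDScheme_of_model_pvIND hI)
  have key : ∀ x : M, A (a / pow2B a (mLen a - x)) := by
    intro x
    refine IsSigmabPVDef.ind hI (P := fun x => A (a / pow2B a (mLen a - x)))
      (isSigmabPVDef_prefix hA a) ?_ ?_ x
    · -- `x = 0`: `⌊a / 2^{|a|}⌋ = 0`
      rw [tsub_zero, (div_pow2B_eq_zero_iff le_rfl a).2 le_rfl]
      exact h0
    · intro x hx
      rcases lt_or_ge x (mLen a) with hlt | hle
      · -- `x < |a|`: one more bit, `a_x = ⌊a_{x+1} / 2⌋`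
        have hd : mLen a - x = mLen a - (x + 1) + 1 := by
          refine (eq_tsub_of_add_eq ?_).symm
          rw [add_assoc, add_comm 1 x, tsub_add_cancel_of_le ((add_one_le_iff' x _).2 hlt)]
        have hd' : mLen a - (x + 1) < mLen a := by
          rw [← add_one_le_iff', ← hd]
          exact tsub_le_self
        apply hs
        rwa [← div_two_eq_mHalf, ← div_pow2B_add_one hd', ← hd]
      · -- `x ≥ |a|`: nothing changes
        rwa [tsub_eq_zero_of_le (hle.trans (le_add_right'' x 1)), ← tsub_eq_zero_of_le hle]
  simpa using key (mLen a)

/-- **`Σᵇᵢ₊₁(PV)-PIND` in models of `T₂ⁱ⁺¹(PV)`**: in a model of `T₂ⁱ⁺¹(PV)`, polynomial induction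
holds for every predicate `Σᵇᵢ₊₁(PV)`-definable with parameters (Buss 1986, Thm. 2.6, Ch. 6;
Krajíček 1995, Lemma 5.2.8, p. 68). [cite: Krajicek1995, Lemma 5.2.8 (p. 68)] -/
theorem pind_of_model_T2PV_succ {i : ℕ} (hM : M ⊨ T2PV (i + 1)) {A : M → Prop}
    (hA : IsSigmabPVDef (i + 1) fun v : Fin 1 → M => A (v 0)) (h0 : A (mZero M))
    (hs : ∀ x, A (mHalf x) → A x) (a : M) : A a := by
  haveI : M ⊨ BASIC := model_BASIC_of_model_T2PV hM
  exact pind_of_pvInd_succ (model_pvIND_of_model_T2PV hM) hA h0 hs a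

/-- **A model of `T₂ⁱ⁺¹(PV)` is a model of `S₂ⁱ⁺¹(PV)`** (`S₂ⁱ(PV) ⊆ T₂ⁱ(PV)` for `i ≥ 1`;
Buss 1986, Thm. 2.6 and its corollary, Ch. 6; Krajíček 1995, Lemma 5.2.8, p. 68): it satisfies
the translated `BASIC` axioms and the defining axioms `PVdef` (common to both theories) and, by
`pind_of_model_T2PV_succ`, every `Σᵇᵢ₊₁(PV)-PIND` axiom. [cite: Krajicek1995, Lemma 5.2.8 (p. 68)] -/
theorem model_S2PV_of_model_T2PV_succ {i : ℕ} (hM : M ⊨ T2PV (i + 1)) : M ⊨ S2PV (i + 1) := by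
  refine ⟨fun φ hφ => ?_⟩
  rcases hφ with hφ | hφ
  · exact hM.realize_of_mem φ (Set.mem_union_left _ hφ)
  · simp only [Set.mem_iUnion, Set.mem_image] at hφ
    obtain ⟨k, ψ, hψ, rfl⟩ := hφ
    rw [realize_pvPindAxiom_iff]
    intro p h0 hs a
    exact pind_of_model_T2PV_succ hM (A := fun x => ψ.Realize (Fin.snoc p x))
      (hψ.isSigmabPVDef_realize_snoc p) h0 hs a

end PIND

/-- **Discharge of `S2PV_succ_extends_to_T2PV_succ`**: for every `i`, `T₂ⁱ⁺¹(PV)` extends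
`S₂ⁱ⁺¹(PV)` — every axiom of `S₂ⁱ⁺¹(PV)` (translated `BASIC`, `PVdef`, and the `Σᵇᵢ₊₁(PV)-PIND`
axioms) is a consequence (`⊨ᵇ`) of `T₂ⁱ⁺¹(PV)`: a model of `T₂ⁱ⁺¹(PV)`, read as an
`L(S₂)`-structure through the reduct along `boundedArithToPV`, is a model of `S₂ⁱ⁺¹(PV)` by
`model_S2PV_of_model_T2PV_succ` (Buss 1986, Thm. 2.6 and its corollary `S₂ⁱ ⊆ T₂ⁱ`, relativised
to `L(PV)`, Ch. 6; Krajíček 1995, Lemma 5.2.8 (p. 68) with Lemma 5.2.5 (p. 67)).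
[cite: Buss1986, Thm. 2.6] [cite: Krajicek1995, Lemma 5.2.8 (p. 68)] -/
theorem S2PV_succ_extends_to_T2PV_succ_holds : S2PV_succ_extends_to_T2PV_succ := by
  intro i φ hφ
  rw [Theory.models_sentence_iff]
  intro N
  haveI : (N : Type) ⊨ S2PV (i + 1) := model_S2PV_of_model_T2PV_succ N.is_model
  exact Theory.realize_sentence_of_mem (S2PV (i + 1)) hφ

/-- **Discharge of `S2PV_extends_to_T2PV`**: for `i ≥ 1`, `T₂ⁱ(PV)` extends `S₂ⁱ(PV)` (Buss 1986,
Thm. 2.6 relativised to `L(PV)`, Ch. 6; Krajíček 1995, Lemma 5.2.8, p. 68); from the successor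
form `S2PV_succ_extends_to_T2PV_succ_holds` at `i = j + 1`.
[cite: Buss1986, Thm. 2.6] [cite: Krajicek1995, Lemma 5.2.8 (p. 68)] -/
theorem S2PV_extends_to_T2PV_holds : S2PV_extends_to_T2PV := by
  intro i hi
  obtain ⟨j, rfl⟩ := Nat.exists_eq_add_of_le' hi
  exact S2PV_succ_extends_to_T2PV_succ_holds j

end Literature.Analysis.FunctionSpaces
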